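import Mathlib
import Literature.Analysis.FluidPDE.VectorCalculus
import Literature.Analysis.FluidPDE.VorticityCalculus
import Summits.NavierStokesRegularity.NavierStokesRegularity.Theorems.UnthreadedDoorFluxStarvedDipoleShellAtRest
import Summits.NavierStokesRegularity.NavierStokesRegularity.Theorems.UnthreadedDoorFluxStarvedDipoleAmplitudeIdentityAll
import HarnessLib

/-!
# Route `UnthreadedDoor`, crux `PoloidalLiouville` (stmt-NavierStokesRegularity-1222), wall W1 — crux idea
# «flux-starved-dipoles»: C2 `DipolarWindowIrrotational` — DIPOLAR UNTHREADED WINDOW FLOWS ARE IRROTATIONAL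

The sketch Prop `FluxStarvedDipole.DipolarWindowIrrotational` VERBATIM (card §Proof step 6): on an open time set `S`, slices
`v(t) ∈ C²` divergence-free, COUPLED `curl v(t) = ∇T(t) × (x−x₀)` with `T` the turning-axis dipole potential of jointly `C³` data
`A, R`, moment bound `‖A‖ ≤ K`, and the law (E1) on `S × {x₀}ᶜ` ⇒ `A ≡ 0` on `S`.  Proof (the card's component argument, made
induction-free): (1) every radius with `A(t,r) ≠ 0` is SOLID — otherwise non-solid radii form a shell on which the flow rests
(`nonSolidDipolarShellAtRestOn`, p839225; unthreadedness is automatic from the coupling), so `curl v = 0` there and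
`A(t,r) × y = 0` on `S_r`, i.e. `A(t,r) = 0`; (2) on `{A(t,·) ≠ 0}` the solid identity `r a′ = a` makes `a/r` locally constant, and
real induction (`IsClosed.Icc_subset_of_forall_exists_gt`) propagates `a(r) = c r` (`c = a(r₀)/r₀ > 0`) to all `r ≥ r₀`,
contradicting `a ≤ K`.

* `dipolarWindowIrrotational` — the sketch Prop C2, unfolded.

HONEST LABEL: the degree-1 stratum of W2 decided in the LINEAR kinematic shadow (critic V28: information-grade, W1/W2 movement 0);
K1′'s parabolic endgame and `DipoleStratumOfWall` remain; `PoloidalLiouville` (1222), its wall `stub_scalarLiouville` and the summit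
stay OPEN; NO Navier–Stokes regularity statement is proved.  `--supports stmt-NavierStokesRegularity-1222` (helper).  [folklore]
-/

noncomputable section

-- the summit and its single sub-problem share the name (CONVENTIONS §1)
set_option linter.dupNamespace false

open Set Filter Topology InnerProductSpace
open scoped RealInnerProductSpace Laplacian
open Literature.Analysis.FluidPDE
open Summit.NavierStokesRegularity.NavierStokesRegularity.Theorems.PoloidalLiouville.HorizonTower (E3)
open Summit.NavierStokesRegularity.NavierStokesRegularity.Theorems.PoloidalLiouville.KinematicShadow (PointSource.cross_smul_right
  PointSource.cross_add_right PointSource.cross_self PointSource.cross_anticomm)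
open Summit.NavierStokesRegularity.NavierStokesRegularity.Theorems.PoloidalLiouville.HorizonTower.Zonal (norm_cross_sq)

namespace Summit.NavierStokesRegularity.NavierStokesRegularity.Theorems.PoloidalLiouville.FluxStarvedDipole

/-- If `A × y = 0` for every `y` on a sphere of positive radius then `A = 0` (take `y ⊥ A`). [folklore] -/
theorem eq_zero_of_cross_sphere_eq_zero {A : E3} {r : ℝ} (hr : 0 < r) (h : ∀ y : E3, ‖y‖ = r → cross A y = 0) : A = 0 := by
  obtain ⟨e, he, heA⟩ := NetFlux.exists_unit_orth A
  have hAe : ⟪A, e⟫ = 0 := by rw [real_inner_comm]; exact heA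
  have hy : ‖r • e‖ = r := by rw [norm_smul, he, mul_one, Real.norm_of_nonneg hr.le]
  have h0 := h (r • e) hy
  have hsq := norm_cross_sq A (r • e)
  rw [h0, norm_zero, hy, inner_smul_right, hAe, mul_zero] at hsq
  norm_num at hsq
  rcases hsq with h | h
  · exact h
  · exact absurd h hr.ne'

/-- **C2 — DIPOLAR UNTHREADED WINDOW FLOWS ARE IRROTATIONAL** — the sketch Prop `FluxStarvedDipole.DipolarWindowIrrotational` VERBATIM
(with `dipolePotentialT`, `dipolePotential`, `KinematicLawOn` unfolded): on an open time set `S`, slices `v(t) ∈ C²` divergence-free,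
coupled `curl v(t) = ∇T(t) × (x − x₀)` to the turning-axis dipole potential with jointly `C³` data and bounded moment `‖A‖ ≤ K`,
obeying (E1) on `S × {x₀}ᶜ` ⇒ `A(t,r) = 0` for all `t ∈ S`, `r > 0`. [folklore] -/
theorem dipolarWindowIrrotational :
    ∀ (S : Set ℝ) (v : ℝ → E3 → E3) (x₀ : E3) (A : ℝ → ℝ → E3) (R : ℝ → ℝ → ℝ) (K : ℝ), IsOpen S →
      (∀ t ∈ S, ContDiff ℝ 2 (v t)) → (∀ t ∈ S, Literature.Analysis.FluidPDE.VectorCalculus.IsDivFree (v t)) →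
      ContDiffOn ℝ 3 (Function.uncurry A) (S ×ˢ Set.Ioi 0) → ContDiffOn ℝ 3 (Function.uncurry R) (S ×ˢ Set.Ioi 0) →
      (∀ t ∈ S, ∀ r > 0, ‖A t r‖ ≤ K) →
      (∀ t ∈ S, ∀ x, x ≠ x₀ →
        curl (v t) x = cross (gradient (fun x => ⟪A t ‖x - x₀‖, x - x₀⟫ / ‖x - x₀‖ + R t ‖x - x₀‖) x) (x - x₀)) →
      (∀ t ∈ S, ∀ x, x ≠ x₀ →
        cross (gradient (fun z => deriv (fun s => ⟪A s ‖z - x₀‖, z - x₀⟫ / ‖z - x₀‖ + R s ‖z - x₀‖) t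
            + ⟪v t z, gradient (fun x => ⟪A t ‖x - x₀‖, x - x₀⟫ / ‖x - x₀‖ + R t ‖x - x₀‖) z⟫
            - Δ (fun x => ⟪A t ‖x - x₀‖, x - x₀⟫ / ‖x - x₀‖ + R t ‖x - x₀‖) z) x) (x - x₀)
          = cross (gradient (fun z => ⟪v t z, z - x₀⟫) x)
              (gradient (fun x => ⟪A t ‖x - x₀‖, x - x₀⟫ / ‖x - x₀‖ + R t ‖x - x₀‖) x)) →
      ∀ t ∈ S, ∀ r > 0, A t r = 0 := by
  intro S v x₀ A R K hS hv hdiv hA hR hK hcurl hlaw t ht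
  have hv1 : ∀ s ∈ S, ContDiff ℝ 1 (v s) := fun s hs => (hv s hs).of_le (by norm_num)
  have hAt : ContDiffOn ℝ 3 (A t) (Ioi 0) := slice_contDiffOn_right hA ht
  have hRt : ContDiffOn ℝ 3 (R t) (Ioi 0) := slice_contDiffOn_right hR ht
  set T : E3 → ℝ := fun x => ⟪A t ‖x - x₀‖, x - x₀⟫ / ‖x - x₀‖ + R t ‖x - x₀‖ with hTdef
  have hT : ∀ z, T z = ⟪A t ‖z - x₀‖, z - x₀⟫ / ‖z - x₀‖ + R t ‖z - x₀‖ := fun z => rfl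
  -- the coupled flow is unthreaded off the centre
  have hunthr : ∀ x : E3, x ≠ x₀ → ⟪x - x₀, curl (v t) x⟫ = 0 := by
    intro x hx
    rw [hcurl t ht x hx, real_inner_comm]
    exact HorizonTower.Zonal.inner_cross_self_right _ _
  -- (1) every radius with `A(t,r) ≠ 0` is solid
  have hsolid : ∀ r > 0, A t r ≠ 0 → r * deriv (fun s => ‖A t s‖) r = ‖A t r‖ := by
    intro r hr hAr
    by_contra hns
    -- an interval of non-solid radii with `A ≠ 0` around `r`
    have hopen : IsOpen (Set.Ioi (0 : ℝ) ∩ (A t) ⁻¹' ({0}ᶜ : Set E3)) :=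
      hAt.continuousOn.isOpen_inter_preimage isOpen_Ioi isOpen_compl_singleton
    have hmem : r ∈ Set.Ioi (0 : ℝ) ∩ (A t) ⁻¹' ({0}ᶜ : Set E3) := ⟨hr, hAr⟩
    have haV : ContDiffOn ℝ 3 (fun s => ‖A t s‖) (Set.Ioi (0 : ℝ) ∩ (A t) ⁻¹' ({0}ᶜ : Set E3)) :=
      (hAt.mono Set.inter_subset_left).norm ℝ fun s hs => hs.2
    have hφc : ContinuousOn (fun s => s * deriv (fun s => ‖A t s‖) s - ‖A t s‖)
        (Set.Ioi (0 : ℝ) ∩ (A t) ⁻¹' ({0}ᶜ : Set E3)) :=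
      (continuousOn_id.mul (haV.continuousOn_deriv_of_isOpen hopen (by norm_num))).sub haV.continuousOn
    have hφr : ContinuousAt (fun s => s * deriv (fun s => ‖A t s‖) s - ‖A t s‖) r := hφc.continuousAt (hopen.mem_nhds hmem)
    have hne : (fun s => s * deriv (fun s => ‖A t s‖) s - ‖A t s‖) r ≠ 0 := fun h => hns (sub_eq_zero.mp h)
    have hev : ∀ᶠ s in 𝓝 r, 0 < s ∧ A t s ≠ 0 ∧ s * deriv (fun s => ‖A t s‖) s ≠ ‖A t s‖ := by
      filter_upwards [hφr.eventually_ne hne, hopen.mem_nhds hmem] with s hs hsV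
      exact ⟨hsV.1, hsV.2, fun h => hs (sub_eq_zero.mpr h)⟩
    obtain ⟨ε, hε, hball⟩ := Metric.eventually_nhds_iff.mp hev
    -- the shell `max(r - ε/2, r/2) < ‖x - x₀‖ < r + ε/2`
    set r₁ : ℝ := max (r - ε / 2) (r / 2) with hr₁
    set r₂ : ℝ := r + ε / 2 with hr₂
    have hr₁0 : 0 ≤ r₁ := le_trans (by positivity : (0 : ℝ) ≤ r / 2) (le_max_right _ _)
    have hr₁r : r₁ < r := max_lt (by linarith) (by linarith)
    have hrr₂ : r < r₂ := by rw [hr₂]; linarith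
    have hin : ∀ s, r₁ < s → s < r₂ → dist s r < ε := by
      intro s hs₁ hs₂
      rw [Real.dist_eq, abs_lt]
      have : r - ε / 2 < s := lt_of_le_of_lt (le_max_left _ _) hs₁
      constructor <;> linarith
    have hrest : ∀ x, r₁ < ‖x - x₀‖ → ‖x - x₀‖ < r₂ → v t x = 0 :=
      nonSolidDipolarShellAtRestOn S v x₀ A R t r₁ r₂ hS ht hr₁0 (hr₁r.trans hrr₂) hv1 hdiv hA hR
        (fun x hx₁ hx₂ => hunthr x (by
          intro h; rw [h, sub_self, norm_zero] at hx₁; exact absurd hx₁ (not_lt.mpr hr₁0)))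
        hlaw (fun s hs₁ hs₂ => (hball (hin s hs₁ hs₂)).2)
    -- `curl v(t) = 0` on `S_r(x₀)`, hence `A(t,r) × y = 0` there
    have hcross : ∀ y : E3, ‖y‖ = r → cross (A t r) y = 0 := by
      intro y hy
      have hy0 : x₀ + y ≠ x₀ := by
        intro h; have : y = 0 := by simpa using h
        rw [this, norm_zero] at hy; exact hr.ne' hy.symm
      have hO : IsOpen {z : E3 | r₁ < ‖z - x₀‖ ∧ ‖z - x₀‖ < r₂} := by
        have hc : Continuous fun z : E3 => ‖z - x₀‖ := continuous_norm.comp (continuous_id.sub continuous_const)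
        exact (isOpen_lt continuous_const hc).inter (isOpen_lt hc continuous_const)
      have hmem' : x₀ + y ∈ {z : E3 | r₁ < ‖z - x₀‖ ∧ ‖z - x₀‖ < r₂} := by
        simp only [mem_setOf_eq, add_sub_cancel_left, hy]; exact ⟨hr₁r, hrr₂⟩
      have hev0 : v t =ᶠ[𝓝 (x₀ + y)] fun _ => (0 : E3) := by
        filter_upwards [hO.mem_nhds hmem'] with z hz
        exact hrest z hz.1 hz.2
      have hfd : fderiv ℝ (v t) (x₀ + y) = 0 := by rw [hev0.fderiv_eq, fderiv_const_apply]
      have hc0 : curl (v t) (x₀ + y) = 0 := curl_eq_zero_of_fderiv_eq_zero hfd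
      rw [hcurl t ht (x₀ + y) hy0, add_sub_cancel_left] at hc0
      obtain ⟨κ, hκ⟩ := dipole_gradient_sphere (x₀ := x₀) hT hAt hRt hr hy
      rw [hκ] at hc0
      have hexp : cross (r⁻¹ • A t r + κ • y) y = r⁻¹ • cross (A t r) y := by
        have cross_add_left' : ∀ a b c : E3, cross (a + b) c = cross a c + cross b c := fun a b c => by
          rw [← crossCLM_apply, ← crossCLM_apply, ← crossCLM_apply, map_add]; rfl
        rw [cross_add_left', cross_smul_left, cross_smul_left, PointSource.cross_self, smul_zero, add_zero]
      rw [hexp] at hc0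
      rcases smul_eq_zero.mp hc0 with h | h
      · exact absurd h (inv_ne_zero hr.ne')
      · exact h
    exact hAr (eq_zero_of_cross_sphere_eq_zero hr hcross)
  -- (2) no radius carries a non-zero moment
  intro r₀ hr₀
  by_contra hA0
  have ha0 : 0 < ‖A t r₀‖ := norm_pos_iff.mpr hA0
  set c : ℝ := ‖A t r₀‖ / r₀ with hc
  have hcpos : 0 < c := div_pos ha0 hr₀
  -- local constancy of `‖A(t,s)‖/s` at solid radii
  have hloc : ∀ x : ℝ, 0 < x → A t x ≠ 0 → ∃ δ > 0, ∀ z ∈ Icc x (x + δ), ‖A t z‖ / z = ‖A t x‖ / x := by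
    intro x hx hAx
    have hopen : IsOpen (Set.Ioi (0 : ℝ) ∩ (A t) ⁻¹' ({0}ᶜ : Set E3)) :=
      hAt.continuousOn.isOpen_inter_preimage isOpen_Ioi isOpen_compl_singleton
    obtain ⟨δ, hδ, hballx⟩ := Metric.isOpen_iff.mp hopen x ⟨hx, hAx⟩
    refine ⟨δ / 2, by positivity, ?_⟩
    have hsub : Icc x (x + δ / 2) ⊆ Set.Ioi (0 : ℝ) ∩ (A t) ⁻¹' ({0}ᶜ : Set E3) := by
      intro z hz
      apply hballx
      rw [Metric.mem_ball, Real.dist_eq, abs_lt]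
      constructor <;> linarith [hz.1, hz.2]
    -- `q = ‖A‖/s` has zero derivative on the interval
    have hqd : ∀ z ∈ Icc x (x + δ / 2), HasDerivAt (fun s => ‖A t s‖ / s) 0 z := by
      intro z hz
      have hzV := hsub hz
      have hz0 : 0 < z := hzV.1
      have hAd : DifferentiableAt ℝ (A t) z := (hAt.differentiableOn (by norm_num)).differentiableAt (Ioi_mem_nhds hz0)
      have had : HasDerivAt (fun s => ‖A t s‖) (deriv (fun s => ‖A t s‖) z) z := (hAd.norm ℝ hzV.2).hasDerivAt
      have h := had.div (hasDerivAt_id z) hz0.ne'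
      refine h.congr_deriv ?_
      simp only [id, mul_one]
      rw [mul_comm, hsolid z hz0 hzV.2, sub_self, zero_div]
    intro z hz
    have hdiff : DifferentiableOn ℝ (fun s => ‖A t s‖ / s) (Icc x (x + δ / 2)) :=
      fun w hw => (hqd w hw).differentiableAt.differentiableWithinAt
    have hder : ∀ w ∈ Ico x (x + δ / 2), derivWithin (fun s => ‖A t s‖ / s) (Icc x (x + δ / 2)) w = 0 := by
      intro w hw
      rw [(hqd w ⟨hw.1, hw.2.le⟩).differentiableAt.derivWithin (uniqueDiffOn_Icc (by linarith) w ⟨hw.1, hw.2.le⟩),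
        (hqd w ⟨hw.1, hw.2.le⟩).deriv]
    exact constant_of_derivWithin_zero hdiff hder z hz
  -- real induction: `‖A(t,s)‖ = c s` on `[r₀, b]` for every `b`
  have hind : ∀ b, r₀ ≤ b → Icc r₀ b ⊆ {s | ‖A t s‖ = c * s} := by
    intro b hb
    apply IsClosed.Icc_subset_of_forall_exists_gt
    · -- closedness of `{‖A‖ = c s} ∩ [r₀, b]`
      have hcont : ContinuousOn (fun s => ‖A t s‖ - c * s) (Icc r₀ b) :=
        ((hAt.continuousOn.norm).mono fun s hs => lt_of_lt_of_le hr₀ hs.1).sub (continuousOn_const.mul continuousOn_id)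
      have : {s | ‖A t s‖ = c * s} ∩ Icc r₀ b = (fun s => ‖A t s‖ - c * s) ⁻¹' {0} ∩ Icc r₀ b := by
        ext s; simp [sub_eq_zero]
      rw [this, Set.inter_comm]
      exact hcont.preimage_isClosed_of_isClosed isClosed_Icc isClosed_singleton
    · show ‖A t r₀‖ = c * r₀
      rw [hc]; field_simp
    · intro x hx y hy
      have hx0 : 0 < x := lt_of_lt_of_le hr₀ hx.2.1
      have hAx : A t x ≠ 0 := by
        intro h
        have h1 : ‖A t x‖ = c * x := hx.1
        rw [h, norm_zero] at h1
        have : 0 < c * x := mul_pos hcpos hx0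
        linarith
      obtain ⟨δ, hδ, hconst⟩ := hloc x hx0 hAx
      refine ⟨min (x + δ) y, ⟨?_, ?_⟩⟩
      · show ‖A t (min (x + δ) y)‖ = c * min (x + δ) y
        have hz : min (x + δ) y ∈ Icc x (x + δ) := ⟨le_min (by linarith) (le_of_lt hy), min_le_left _ _⟩
        have h := hconst _ hz
        have hx1 : ‖A t x‖ / x = c := by rw [show ‖A t x‖ = c * x from hx.1]; field_simp
        rw [hx1] at h
        have hz0 : 0 < min (x + δ) y := lt_min (by linarith) (lt_trans hx0 hy)
        field_simp at h
        linarith [h]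
      · exact ⟨lt_min (by linarith) hy, min_le_right _ _⟩
  -- contradiction with the moment bound at a large radius
  set b : ℝ := max r₀ (K / c + 1) with hb
  have hb0 : r₀ ≤ b := le_max_left _ _
  have hbpos : 0 < b := lt_of_lt_of_le hr₀ hb0
  have hAb : ‖A t b‖ = c * b := hind b hb0 ⟨hb0, le_refl _⟩
  have hKb : ‖A t b‖ ≤ K := hK t ht b hbpos
  have : K / c + 1 ≤ b := le_max_right _ _
  have : K < c * b := by
    calc K = c * (K / c) := by field_simp
      _ < c * (K / c + 1) := by nlinarith
      _ ≤ c * b := by nlinarith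
  linarith

end Summit.NavierStokesRegularity.NavierStokesRegularity.Theorems.PoloidalLiouville.FluxStarvedDipole

end
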